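import Summits.QuantumFields.YangMills.Theorems.FlatTubeReductionDressedOneOrbitRate
import Summits.QuantumFields.YangMills.Theorems.FlatTubeReductionDressedClusterAbsorptionPot
import HarnessLib

/-!
# DRESSED ONE-SITE NO-INTRUDER WITH RATE AND AN ADDITIVE SECOND-MOMENT POTENTIAL ⟸ the one-site sub-target (EM)
# (`hDS′` of skeleton «ratepack-v3 / frozen fibres»; route `FlatTubeReduction`, crux K1 `NearFlatRatioLaw` stmt-QuantumFields-24720; seat `ym-line-ftr-p1` g12; R2b1 RECORD rung — no summit)

WHY (lead g12, crux workfile `Cruxes/NearFlatRatioLaw/Lines/ratepack-v3-frozen-g12.md`).  With FROZEN fibre profiles (lane A's objects) the off-diagonal Feshbach coupling is budgeted as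
`b(u)² ≲ λ_b³ + κ_b·orbitDist(u)²`; after the completed square the one-site comparison carries an ADDITIVE POTENTIAL `κ_E·μ₀·∫_{orbitDist<δ} orbitDist²·φ²` (`κ_E = O(κ_b/θ₀)`),
`O(λ_b)μ₀` at the edge of the `β^{-1/6}` window but `O(λ_b²)μ₀` on low one-site eigenfunctions by (EM).  ★★★ `dressedOneOrbitRatePot_of_eigenMoments`: (EM) ⟹ for physical weights
`W` (`|W² − 1| ≤ κ_W·orbitDist²` on a window of radius `δ(B)`, `κ_Wδ² ≤ Aλ_b`, `κ_Eδ² ≤ Aλ_b`) and every bounded measurable gauge-invariant `(k+1)`-family `G` supported in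
`{orbitDist < δ(B)}`, some `a ≠ 0` has `(⟨(ΣaG)W, K_B(ΣaG)W⟩ + κ_E·μ₀·∫_{orbitDist<δ} orbitDist²·(ΣaG)²)·μ₀ ≤ e^{Cλ_b²}·μ_k·μ₀·‖ΣaG‖²`.  Proof = p660362 with the cluster absorption
replaced by `qform_dressed_pot_le_of_cluster` (p672515): twist-symmetrised potential `Σ_z D_δ∘τ_z ≤ 8δ²`, its span form `≤ 8(n+1)Sλ_b²` by (EM), gap index `cluster_gap k (64A)`.
HONEST FRAMING: one-site linear algebra over tree objects; (EM) is PROVED (`RateTube.oneSiteEigenMoments`) but kept as a hypothesis (parallel to p660362); the lattice bricks of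
«ratepack-v3» stay OPEN; femto rung R2b1 (RECORD label); not infinite volume, not a gap, not Clay.  No defs, no named facts, no `sorry`.
-/

set_option autoImplicit false

noncomputable section

open MeasureTheory Filter Topology Real
open scoped BigOperators
open Literature.MathematicalPhysics.QuantumFieldTheory
open Literature.MathematicalPhysics.QuantumLattice

namespace Summit.QuantumFields.YangMills.Theorems.FemtoTransferGap.RateTube

open Summit.QuantumFields.YangMills.Theorems.FemtoTransferGap
open Summit.QuantumFields.YangMills.Theorems.FemtoCutoffLadder
open Summit.QuantumFields.YangMills.Theorems.FemtoTransferGap.TwoLattice.ConstTube (l2_self_eq_integral_sq)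

variable {L : ℕ} [NeZero L]

/-! ## §1 The twist-symmetrised window potential -/

/-- The windowed second-moment weight `D_δ(u) = 𝟙{orbitDist u < δ}·orbitDist(u)²`: measurable, `0 ≤ D_δ ≤ δ²`, gauge invariant. [folklore] -/
theorem windowMoment_props (δ : ℝ) :
    Measurable (fun v : GaugeConfig 3 L SU2 => if orbitDist v < δ then orbitDist v ^ 2 else 0) ∧
    (∀ v : GaugeConfig 3 L SU2, 0 ≤ (if orbitDist v < δ then orbitDist v ^ 2 else 0)) ∧
    (∀ v : GaugeConfig 3 L SU2, (if orbitDist v < δ then orbitDist v ^ 2 else 0) ≤ δ ^ 2) ∧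
    (∀ (g : Site 3 L → SU2) (v : GaugeConfig 3 L SU2),
      (if orbitDist (gaugeTransform g v) < δ then orbitDist (gaugeTransform g v) ^ 2 else 0) = if orbitDist v < δ then orbitDist v ^ 2 else 0) := by
  refine ⟨Measurable.ite (measurableSet_lt measurable_orbitDist measurable_const) (measurable_orbitDist.pow_const 2) measurable_const,
    fun v => ?_, fun v => ?_, fun g v => by rw [orbitDist_gaugeTransform]⟩
  · split_ifs <;> positivity
  · split_ifs with h
    · exact pow_le_pow_left₀ (orbitDist_nonneg v) h.le 2
    · positivity

/-- ★ For a bounded measurable `G` supported in `{orbitDist < δ}` with `L·δ < 2` (disjoint twist copies):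
`8·∫ D_δ·G² ≤ ∫ (Σ_z D_δ∘τ_z)·(twistSum G)²` — in fact equality; only this direction is used. [folklore] -/
theorem integral_windowMoment_le_twist {δ : ℝ} (hLδ : (L : ℝ) * δ < 2) {G : GaugeConfig 3 L SU2 → ℝ} (hGm : Measurable G) {CG : ℝ}
    (hGb : ∀ u, |G u| ≤ CG) (hGg : ∀ (g : Site 3 L → SU2) (u : GaugeConfig 3 L SU2), G (gaugeTransform g u) = G u) (hGs : ∀ u, G u ≠ 0 → orbitDist u < δ) :
    8 * ∫ u, (if orbitDist u < δ then orbitDist u ^ 2 else 0) * G u ^ 2 ∂configMeasure SU2 L ≤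
      ∫ u, (∑ z : Fin 3 → Bool, (if orbitDist (TT.twist3 z u) < δ then orbitDist (TT.twist3 z u) ^ 2 else 0)) * twistSum G u ^ 2 ∂configMeasure SU2 L := by
  obtain ⟨hDm, hD0, hDδ, -⟩ := windowMoment_props (L := L) δ
  have hΨ : IsPhys (twistSum G) := isPhys_twistSum hGm ⟨CG, hGb⟩ hGg
  rw [integral_sum_twist_mul_sq hDm (CD := δ ^ 2) (fun u => by rw [abs_of_nonneg (hD0 u)]; exact hDδ u) hΨ]
  refine mul_le_mul_of_nonneg_left ?_ (by norm_num)
  have hCG : 0 ≤ CG := (abs_nonneg _).trans (hGb 1)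
  obtain ⟨CΨ, hCΨ⟩ := hΨ.bounded
  refine integral_mono ?_ ?_ fun u => ?_
  · exact integrable_of_measurable_abs_le _ (hDm.mul (hGm.pow_const 2)) (C := δ ^ 2 * CG ^ 2) fun u => by
      rw [abs_mul, abs_pow, abs_of_nonneg (hD0 u)]; exact mul_le_mul (hDδ u) (pow_le_pow_left₀ (abs_nonneg _) (hGb u) 2) (by positivity) (by positivity)
  · exact integrable_of_measurable_abs_le _ (hDm.mul (hΨ.measurable.pow_const 2)) (C := δ ^ 2 * CΨ ^ 2) fun u => by
      rw [abs_mul, abs_pow, abs_of_nonneg (hD0 u)]; exact mul_le_mul (hDδ u) (pow_le_pow_left₀ (abs_nonneg _) (hCΨ u) 2) (by positivity) (by positivity)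
  · -- pointwise: `(twistSum G)² = Σ_z (G∘τ_z)² ≥ (G∘τ_0)² = G²`
    dsimp only
    refine mul_le_mul_of_nonneg_left ?_ (hD0 u)
    have hsq : twistSum G u ^ 2 = ∑ z : Fin 3 → Bool, G (TT.twist3 z u) ^ 2 := by
      rw [sq, twistSum_mul_self hLδ hGs u]; exact Finset.sum_congr rfl fun z _ => by rw [sq]
    rw [hsq]
    have h := Finset.single_le_sum (f := fun z : Fin 3 → Bool => G (TT.twist3 z u) ^ 2) (fun z _ => sq_nonneg _) (Finset.mem_univ (fun _ => false))
    simp only [TT.twist3_false] at h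
    exact h

/-! ## §2 ★★★ The dressed one-site no-intruder with rate and potential, modulo (EM) -/

set_option maxHeartbeats 800000 in
/-- ★★★ **THE DRESSED ONE-SITE NO-INTRUDER WITH RATE AND POTENTIAL, modulo (EM)** — see the module docstring.  The conclusion is the brick field `hDS′` of «ratepack-v3» at the
one-site coupling `B` (every level `k`), for physical weights with `|W² − 1| ≤ κ_W·orbitDist²` on a window of radius `δ(B)` with `κ_Wδ² ≤ Aλ_b(B)` and a potential coupling
`κ_E ≥ 0` with `κ_Eδ² ≤ Aλ_b(B)`. [cite: Luscher1983, §2–§3] [cite: ReedSimonIV1978, Thm. XIII.1] -/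
theorem dressedOneOrbitRatePot_of_eigenMoments (hEM : OneSiteEigenMoments) (k : ℕ) {δ : ℝ → ℝ} {W : ℝ → (GaugeConfig 3 1 SU2 → ℝ)} {κW CW A κE : ℝ}
    (hκW : 0 ≤ κW) (hA : 0 ≤ A) (hκE : 0 ≤ κE) (hW : ∀ B, IsPhys (W B)) (hWb : ∀ B u, |W B u| ≤ CW) (hW0 : ∀ B u, 0 ≤ W B u)
    (hWsq : ∀ B u, orbitDist u < δ B → |W B u ^ 2 - 1| ≤ κW * orbitDist u ^ 2)
    (hδ : ∃ B1 : ℝ, ∀ B : ℝ, B1 ≤ B → 0 < δ B ∧ δ B ≤ 1 / 2 ∧ κW * δ B ^ 2 ≤ A * bareLambda B ∧ κE * δ B ^ 2 ≤ A * bareLambda B) :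
    ∃ C B₀ : ℝ, ∀ B : ℝ, B₀ ≤ B → ∀ G : Fin (k + 1) → (GaugeConfig 3 1 SU2 → ℝ),
      (∀ i, Measurable (G i)) → (∀ i, ∃ C' : ℝ, ∀ u, |G i u| ≤ C') →
      (∀ i (g : Site 3 1 → SU2) (u : GaugeConfig 3 1 SU2), G i (gaugeTransform g u) = G i u) →
      (∀ i u, G i u ≠ 0 → orbitDist u < δ B) →
        ∃ a : Fin (k + 1) → ℝ, a ≠ 0 ∧
          (qform su2Rep B (fun u => (∑ i, a i * G i u) * W B u) (fun u => (∑ i, a i * G i u) * W B u) +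
              κE * levelValue su2Rep 1 B 0 * ∫ u, (if orbitDist u < δ B then orbitDist u ^ 2 else 0) * (∑ i, a i * G i u) ^ 2 ∂configMeasure SU2 1) *
            levelValue su2Rep 1 B 0 ≤
            Real.exp (C * bareLambda B ^ 2) * levelValue su2Rep 1 B k * levelValue su2Rep 1 B 0 *
              l2 (fun u => ∑ i, a i * G i u) (fun u => ∑ i, a i * G i u) := by
  classical
  -- the cluster index (gap budget `64A`: dressing `2Aλμ_n` + potential `32Aλμ_k`) and the one-site constants
  obtain ⟨n, hkn1, Cg, Bg, hCg0, hgap⟩ := cluster_gap k (A := 64 * A) (by positivity)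
  have hkn : k ≤ n := (Nat.le_succ k).trans hkn1
  obtain ⟨S, BS, hS0, hEMn⟩ := hEM n
  obtain ⟨B1, hδ1⟩ := hδ
  obtain ⟨Bc, hcross⟩ := crossBound_eventually_small_sq (L := 1) (m := 1 / 2) (by norm_num) one_pos
  have hCW0 : 0 ≤ CW := (abs_nonneg _).trans (hWb 0 1)
  -- smallness `128Aλ ≤ 1`
  set τ : ℝ := 1 / (128 * A + 1) with hτ
  have hτ0 : 0 < τ := by rw [hτ]; positivity
  set cV : ℝ := 8 * κW * (n + 1) * S with hcV
  have hcV0 : 0 ≤ cV := by positivity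
  set cw2 : ℝ := (n + 1) * A * cV with hcw2
  have hcw20 : 0 ≤ cw2 := by positivity
  set C : ℝ := 2 * cV + 32 * κE * (n + 1) * S + Cg * (2 * Real.sqrt cw2 + cw2) + CW ^ 2 / 2 with hCdef
  refine ⟨C, max (max Bg BS) (max (max B1 Bc) (max 1 (2 / τ ^ 3))), fun B hB G hGm hGb hGg hGs => ?_⟩
  simp only [max_le_iff] at hB
  obtain ⟨⟨hBg, hBS⟩, ⟨hB1, hBc⟩, hBone, hBτ⟩ := hB
  have hB0 : 0 < B := by linarith
  obtain ⟨hμ0, hμk2, hμn0, hμnk, hμkn, hlam0, hlam1⟩ := hgap B hBg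
  obtain ⟨hδ0, hδhalf, hκδ, hκEδ⟩ := hδ1 B hB1
  set lam : ℝ := bareLambda B with hlam
  set μ0 : ℝ := levelValue su2Rep 1 B 0 with hμ0def
  set μk : ℝ := levelValue su2Rep 1 B k with hμkdef
  set μn : ℝ := levelValue su2Rep 1 B n with hμndef
  have hμkpos : 0 < μk := by linarith
  have hμ0k : μ0 ≤ 2 * μk := by linarith
  have hμn_le_k : μn ≤ μk := by
    have h1 : μn * 1 ≤ μn * (1 + 2 * (64 * A) * lam) := mul_le_mul_of_nonneg_left (by nlinarith [mul_nonneg hA hlam0.le]) hμn0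
    linarith [hμnk]
  -- `128Aλ ≤ 1`
  have hlamτ : lam ≤ τ := by
    have h := bareLambda_cube_le (L := 1) hτ0 hBτ
    have e1B : ((1 : ℕ) : ℝ) ^ 3 * B = B := by rw [Nat.cast_one, one_pow, one_mul]
    rw [e1B] at h; exact h
  have hAlam : 128 * A * lam ≤ 1 := by
    have h2 : 128 * A * τ ≤ 1 := by rw [hτ, mul_one_div, div_le_one (by positivity)]; linarith
    exact (mul_le_mul_of_nonneg_left hlamτ (by positivity)).trans h2
  have hLδ : ((1 : ℕ) : ℝ) * δ B < 2 := by rw [Nat.cast_one, one_mul]; linarith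
  have hLm : ((1 : ℕ) : ℝ) * (δ B + 1 / 2) < 2 := by rw [Nat.cast_one, one_mul]; linarith
  have e1B : ((1 : ℕ) : ℝ) ^ 3 * B = B := by rw [Nat.cast_one, one_pow, one_mul]
  obtain ⟨e, he, hon, heig, hdom⟩ := exists_isPhys_eigenfamily_dominating_of_pos (L := 1) hB0 n
  have hMom : ∀ i : Fin (n + 1), ∫ u, (if orbitDist u < 1 / 2 then orbitDist u ^ 2 else 0) * e i u ^ 2 ∂configMeasure SU2 1 ≤ S * lam ^ 2 := by
    intro i
    have h := hEMn B hBS (e i) (he i) ⟨i, Nat.lt_succ_iff.mp i.isLt, heig i⟩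
    have h1 : l2 (e i) (e i) = 1 := by rw [hon]; simp
    rw [h1, mul_one] at h; exact h
  choose CG hCG using hGb
  set Ψ : Fin (k + 1) → GaugeConfig 3 1 SU2 → ℝ := fun i => twistSum (G i) with hΨdef
  have hΨ : ∀ i, IsPhys (Ψ i) := fun i => isPhys_twistSum (hGm i) ⟨CG i, hCG i⟩ (hGg i)
  set W' : GaugeConfig 3 1 SU2 → ℝ := W B with hW'def
  have hW' : IsPhys W' := hW B
  have hF : ∀ i, IsPhys (fun u => Ψ i u * W' u) := fun i => OpPlat.isPhys_mul (hΨ i) hW'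
  have hkn' : k ≤ n + 1 := hkn.trans (Nat.le_succ n)
  obtain ⟨a, ha, hperp0⟩ := exists_coeff_orthogonal (fun i => fun u => Ψ i u * W' u) hF (fun j : Fin k => e ⟨j, lt_of_lt_of_le j.isLt hkn'⟩)
    (fun j => he _)
  refine ⟨a, ha, ?_⟩
  have hGam : Measurable (fun u => ∑ i, a i * G i u) := Finset.measurable_sum _ fun i _ => (hGm i).const_mul _
  have hGab : ∀ u, |∑ i, a i * G i u| ≤ ∑ i, |a i| * CG i := fun u =>
    (Finset.abs_sum_le_sum_abs _ _).trans (Finset.sum_le_sum fun i _ => by rw [abs_mul]; exact mul_le_mul_of_nonneg_left (hCG i u) (abs_nonneg _))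
  have hGag : ∀ (g : Site 3 1 → SU2) u, (∑ i, a i * G i (gaugeTransform g u)) = ∑ i, a i * G i u := fun g u =>
    Finset.sum_congr rfl fun i _ => by rw [hGg]
  have hGas : ∀ u, (∑ i, a i * G i u) ≠ 0 → orbitDist u < δ B := fun u h => by
    by_contra hlt
    exact h (Finset.sum_eq_zero fun i _ => by
      have : G i u = 0 := by by_contra hi; exact hlt (hGs i u hi)
      rw [this, mul_zero])
  set Ψa : GaugeConfig 3 1 SU2 → ℝ := fun u => ∑ i, a i * Ψ i u with hΨadef
  have hΨa : IsPhys Ψa := isPhys_sum_mul_lat Finset.univ Ψ hΨ a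
  have hΨa_eq : Ψa = twistSum (fun u => ∑ i, a i * G i u) := by rw [twistSum_sum_mul]
  -- the symmetrised window and the absorption lemma's hypotheses
  set Sset : Set (GaugeConfig 3 1 SU2) := {u | twistSum (fun v => if orbitDist v < δ B then (1 : ℝ) else 0) u ≠ 0} with hSset
  obtain ⟨hSm, hSg, hSz⟩ := twistWindow_set_props (L := 1) (δ B)
  have hΨaS : ∀ u, Ψa u ≠ 0 → u ∈ Sset := by
    intro u hu
    rw [hΨa_eq] at hu
    obtain ⟨z, -, hz⟩ := Finset.exists_ne_zero_of_sum_ne_zero hu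
    exact (twistWindow_ne_zero_iff (δ B) u).mpr ⟨z, hGas _ hz⟩
  set κbar : ℝ := κW * δ B ^ 2 with hκbar
  have hκbar0 : 0 ≤ κbar := by positivity
  have hκS : ∀ u ∈ Sset, |W' u ^ 2 - 1| ≤ κbar := by
    intro u hu
    obtain ⟨z, hz⟩ := (twistWindow_ne_zero_iff (δ B) u).mp hu
    rw [← TT.twist3_eq_of_isPhys hW' z u]
    exact (hWsq B _ hz).trans (mul_le_mul_of_nonneg_left (pow_le_pow_left₀ (orbitDist_nonneg _) hz.le 2) hκW)
  have hV := fun c : Fin (n + 1) → ℝ => dressed_moment_form_le hW' hκW hδhalf (hWsq B) he hMom c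
  have hwO := dressed_overlap_le hW' (hW0 B) hκW hδhalf (hWsq B) he hMom
  set V : ℝ := cV * lam ^ 2 with hVdef
  have hV0 : 0 ≤ V := by positivity
  have hV' : ∀ c : Fin (n + 1) → ℝ, ∫ u, Sset.indicator (fun u => |W' u ^ 2 - 1|) u * (∑ i, c i * e i u) ^ 2 ∂configMeasure SU2 1 ≤ V * ∑ i, c i ^ 2 := by
    intro c
    refine (hV c).trans (le_of_eq ?_)
    rw [hVdef, hcV]; ring
  set w : ℝ := Real.sqrt cw2 * lam with hwdef
  have hw0 : 0 ≤ w := by positivity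
  have hw2 : ∑ i : Fin (n + 1), l2 (fun u => Sset.indicator 1 u * (W' u - 1) * e i u) (fun u => Sset.indicator 1 u * (W' u - 1) * e i u) ≤ w ^ 2 := by
    refine hwO.trans ?_
    have h1 : (n + 1) * (κW * δ B ^ 2) * (8 * κW * (n + 1) * (S * lam ^ 2)) ≤ (n + 1) * (A * lam) * (8 * κW * (n + 1) * (S * lam ^ 2)) :=
      mul_le_mul_of_nonneg_right (mul_le_mul_of_nonneg_left hκδ (by positivity)) (by positivity)
    have h2 : (n + 1) * (A * lam) * (8 * κW * (n + 1) * (S * lam ^ 2)) = cw2 * lam ^ 3 := by rw [hcw2, hcV]; ring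
    have h3 : cw2 * lam ^ 3 ≤ cw2 * lam ^ 2 := by
      refine mul_le_mul_of_nonneg_left ?_ hcw20
      calc lam ^ 3 = lam ^ 2 * lam := by ring
        _ ≤ lam ^ 2 * 1 := mul_le_mul_of_nonneg_left hlam1 (sq_nonneg lam)
        _ = lam ^ 2 := mul_one _
    have h4 : w ^ 2 = cw2 * lam ^ 2 := by rw [hwdef, mul_pow, Real.sq_sqrt hcw20]
    linarith [h1, h2, h3, h4]
  -- the twist-symmetrised window potential `D̃ = Σ_z D_δ∘τ_z`, `0 ≤ D̃ ≤ 8δ²`, and its second-moment form on the span `≤ 8(n+1)Sλ²`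
  obtain ⟨hDm, hD0, hDδ, hDg⟩ := windowMoment_props (L := 1) (δ B)
  set D0 : GaugeConfig 3 1 SU2 → ℝ := fun v => if orbitDist v < δ B then orbitDist v ^ 2 else 0 with hD0def
  set Dt : GaugeConfig 3 1 SU2 → ℝ := fun u => ∑ z : Fin 3 → Bool, D0 (TT.twist3 z u) with hDtdef
  have hDtm : Measurable Dt := Finset.measurable_sum _ fun z _ => hDm.comp (TT.measurable_twist3 z)
  have hDt0 : ∀ u, 0 ≤ Dt u := fun u => Finset.sum_nonneg fun z _ => hD0 _
  have hDt8 : ∀ u, Dt u ≤ 8 * δ B ^ 2 := fun u => by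
    calc Dt u ≤ ∑ _z : Fin 3 → Bool, δ B ^ 2 := Finset.sum_le_sum fun z _ => hDδ _
      _ = 8 * δ B ^ 2 := by rw [Finset.sum_const, Finset.card_univ, TT.card_twists, nsmul_eq_mul]; norm_num
  have hDtb : ∀ u, |Dt u| ≤ 8 * δ B ^ 2 := fun u => by rw [abs_of_nonneg (hDt0 u)]; exact hDt8 u
  set VD : ℝ := 8 * ((n + 1) * (S * lam ^ 2)) with hVDdef
  have hVD0 : 0 ≤ VD := by positivity
  have hVD : ∀ c : Fin (n + 1) → ℝ, ∫ u, Dt u * (∑ i, c i * e i u) ^ 2 ∂configMeasure SU2 1 ≤ VD * ∑ i, c i ^ 2 := by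
    intro c
    have hcomb : IsPhys (fun u => ∑ i, c i * e i u) := isPhys_sum_mul_lat Finset.univ e he c
    have h8 := integral_sum_twist_mul_sq hDm (CD := δ B ^ 2) (fun u => by rw [abs_of_nonneg (hD0 u)]; exact hDδ u) hcomb
    have hMom' : ∀ i : Fin (n + 1), ∫ u, D0 u * e i u ^ 2 ∂configMeasure SU2 1 ≤ S * lam ^ 2 := by
      intro i
      refine le_trans (integral_mono ?_ ?_ fun u => ?_) (hMom i)
      · obtain ⟨Ce, hCe⟩ := (he i).bounded
        exact integrable_of_measurable_abs_le _ (hDm.mul ((he i).measurable.pow_const 2)) (C := δ B ^ 2 * Ce ^ 2) fun u => by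
          rw [abs_mul, abs_pow, abs_of_nonneg (hD0 u)]; exact mul_le_mul (hDδ u) (pow_le_pow_left₀ (abs_nonneg _) (hCe u) 2) (by positivity) (by positivity)
      · obtain ⟨Ce, hCe⟩ := (he i).bounded
        have hm' : Measurable (fun v : GaugeConfig 3 1 SU2 => if orbitDist v < 1 / 2 then orbitDist v ^ 2 else 0) :=
          Measurable.ite (measurableSet_lt measurable_orbitDist measurable_const) (measurable_orbitDist.pow_const 2) measurable_const
        exact integrable_of_measurable_abs_le _ (hm'.mul ((he i).measurable.pow_const 2)) (C := (1 / 2) ^ 2 * Ce ^ 2) fun u => by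
          rw [abs_mul, abs_pow]
          refine mul_le_mul ?_ (pow_le_pow_left₀ (abs_nonneg _) (hCe u) 2) (by positivity) (by positivity)
          split_ifs with h
          · rw [abs_of_nonneg (by positivity)]; exact pow_le_pow_left₀ (orbitDist_nonneg u) h.le 2
          · rw [abs_zero]; positivity
      · refine mul_le_mul_of_nonneg_right ?_ (sq_nonneg _)
        show (if orbitDist u < δ B then orbitDist u ^ 2 else 0) ≤ (if orbitDist u < 1 / 2 then orbitDist u ^ 2 else 0)
        by_cases h : orbitDist u < δ B
        · rw [if_pos h, if_pos (lt_of_lt_of_le h hδhalf)]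
        · rw [if_neg h]; split_ifs <;> positivity
    have hcomb2 := integral_weight_combination_sq_le hDm (CD := δ B ^ 2) (fun u => by rw [abs_of_nonneg (hD0 u)]; exact hDδ u) hD0 he hMom' c
    rw [hDtdef]
    show ∫ u, (∑ z : Fin 3 → Bool, D0 (TT.twist3 z u)) * (∑ i, c i * e i u) ^ 2 ∂configMeasure SU2 1 ≤ VD * ∑ i, c i ^ 2
    rw [h8, hVDdef]
    nlinarith [hcomb2, Finset.sum_nonneg (fun i (_ : i ∈ Finset.univ) => sq_nonneg (c i))]
  -- the coupling `μ = κ_E μ₀` and the GAP CONDITION `2κ̄μ_n + 2μ(8δ²) ≤ μ_k − μ_n`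
  set μ : ℝ := κE * μ0 with hμdef
  have hμ0' : 0 ≤ μ := mul_nonneg hκE hμ0.le
  have hgapc : 2 * κbar * μn + 2 * μ * (8 * δ B ^ 2) ≤ μk - μn := by
    -- `2κ̄μ_n ≤ 2Aλμ_n`, `16κ_Eδ²μ₀ ≤ 16Aλμ₀ ≤ 32Aλμ_k`, and `μ_k − μ_n ≥ 128Aλμ_n`, `μ_k − μ_n ≥ 64Aλμ_k` (from `μ_n(1+128Aλ) ≤ μ_k`, `128Aλ ≤ 1`)
    have hAl0 : 0 ≤ A * lam := mul_nonneg hA hlam0.le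
    have h1 : 2 * κbar * μn ≤ 2 * (A * lam) * μn := by
      have := mul_le_mul_of_nonneg_right hκδ hμn0
      linarith [this]
    have h2 : 2 * μ * (8 * δ B ^ 2) ≤ 32 * (A * lam) * μk := by
      have h3 : 2 * μ * (8 * δ B ^ 2) = 16 * ((κE * δ B ^ 2) * μ0) := by rw [hμdef]; ring
      have h4 : (κE * δ B ^ 2) * μ0 ≤ (A * lam) * μ0 := mul_le_mul_of_nonneg_right hκEδ hμ0.le
      have h4' : (A * lam) * μ0 ≤ (A * lam) * (2 * μk) := mul_le_mul_of_nonneg_left hμ0k hAl0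
      rw [h3]; linarith [h4, h4']
    have hμnk' : μn * (1 + 128 * (A * lam)) ≤ μk := by
      have e : 1 + 2 * (64 * A) * lam = 1 + 128 * (A * lam) := by ring
      rw [e] at hμnk; exact hμnk
    have hdiff0 : 0 ≤ μk - μn := by linarith
    have h5 : 128 * (A * lam) * μn ≤ μk - μn := by
      have e : μn * (1 + 128 * (A * lam)) = μn + 128 * ((A * lam) * μn) := by ring
      rw [e] at hμnk'; linarith [hμnk']
    have h6 : 64 * (A * lam) * μk ≤ μk - μn := by
      have h6a : 128 * (A * lam) * μk ≤ (μk - μn) * (1 + 128 * (A * lam)) := by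
        have e1 : (μk - μn) * (1 + 128 * (A * lam)) = μk * (1 + 128 * (A * lam)) - μn * (1 + 128 * (A * lam)) := by ring
        have e2 : μk * (1 + 128 * (A * lam)) = μk + 128 * (A * lam) * μk := by ring
        rw [e1, e2]; linarith [hμnk']
      have h6b : (μk - μn) * (1 + 128 * (A * lam)) ≤ (μk - μn) * 2 := by
        refine mul_le_mul_of_nonneg_left ?_ hdiff0
        have : 128 * (A * lam) = 128 * A * lam := by ring
        linarith [hAlam, this]
      linarith [h6a, h6b]
    linarith [h1, h2, h5, h6, mul_nonneg hAl0 hμn0, mul_nonneg hAl0 hμkpos.le]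
  -- orthogonality `Ψ_a W ⊥ e_{<k}`
  have hcombF : (fun u => W' u * Ψa u) = fun u => ∑ i, a i * (Ψ i u * W' u) := by
    funext u; simp only [hΨadef]; rw [Finset.mul_sum]; exact Finset.sum_congr rfl fun i _ => by ring
  have hperp : ∀ i : Fin (n + 1), (i : ℕ) < k → l2 (fun u => W' u * Ψa u) (e i) = 0 := by
    intro i hi
    rw [hcombF]
    have h := hperp0 ⟨i, hi⟩
    have e2 : (⟨((⟨i, hi⟩ : Fin k) : ℕ), lt_of_lt_of_le ((⟨i, hi⟩ : Fin k)).isLt hkn'⟩ : Fin (n + 1)) = i := Fin.ext rfl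
    rw [e2] at h; exact h
  -- ★ CLUSTER ABSORPTION WITH POTENTIAL
  have habs := qform_dressed_pot_le_of_cluster (L := 1) hB0 he hon heig hdom hkn hW'.measurable (hWb B) hW'.gaugeInv hW'.zeroFlux hSm hSg hSz
    hκbar0 hκS hV0 hV' hw0 hw2 hDtm hDtb hDt0 (κD := 8 * δ B ^ 2) (by positivity) (fun u _ => hDt8 u) hVD0 hμ0' hVD hgapc hΨa hΨaS hperp
  -- undo the eight copies
  have hl2Ψ : l2 Ψa Ψa = 8 * l2 (fun u => ∑ i, a i * G i u) (fun u => ∑ i, a i * G i u) := by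
    rw [hΨa_eq]; exact l2_twistSum hGam hGab hLδ hGas
  have hGWm : Measurable (fun u => (∑ i, a i * G i u) * W' u) := hGam.mul hW'.measurable
  have hGWb : ∀ u, |(∑ i, a i * G i u) * W' u| ≤ (∑ i, |a i| * CG i) * CW := fun u => by
    rw [abs_mul]; exact mul_le_mul (hGab u) (hWb B u) (abs_nonneg _) ((abs_nonneg _).trans (hGab u))
  have hGWs : ∀ u, (∑ i, a i * G i u) * W' u ≠ 0 → orbitDist u < δ B := fun u h => hGas u (left_ne_zero_of_mul h)
  have htw : (fun u => W' u * Ψa u) = twistSum (fun u => (∑ i, a i * G i u) * W' u) := by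
    funext u; rw [twistSum_mul_of_isPhys _ hW' u, ← hΨa_eq]; ring
  have hq8 := abs_qform_twistSum_sub_le hB0.le hGWm hGWb (by norm_num : (0 : ℝ) ≤ 1 / 2) hLm hGWs
  rw [← htw] at hq8
  have hl2GW : l2 (fun u => (∑ i, a i * G i u) * W' u) (fun u => (∑ i, a i * G i u) * W' u) ≤ CW ^ 2 * l2 (fun u => ∑ i, a i * G i u) (fun u => ∑ i, a i * G i u) := by
    rw [l2_self_eq_integral_sq, l2_self_eq_integral_sq, ← integral_const_mul]
    refine integral_mono ?_ ?_ fun u => ?_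
    · exact integrable_of_measurable_abs_le _ (hGWm.pow_const 2) (C := ((∑ i, |a i| * CG i) * CW) ^ 2) fun u => by
        rw [abs_pow]; exact pow_le_pow_left₀ (abs_nonneg _) (hGWb u) 2
    · exact (integrable_of_measurable_abs_le _ (hGam.pow_const 2) (C := (∑ i, |a i| * CG i) ^ 2) fun u => by
        rw [abs_pow]; exact pow_le_pow_left₀ (abs_nonneg _) (hGab u) 2).const_mul _
    · dsimp only
      have h1 : W' u ^ 2 ≤ CW ^ 2 := by
        have h2 : |W' u| ≤ CW := hWb B u
        rw [← sq_abs]; exact pow_le_pow_left₀ (abs_nonneg _) h2 2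
      rw [mul_pow, mul_comm]
      exact mul_le_mul_of_nonneg_right h1 (sq_nonneg _)
  -- the potential of the one-copy combination is `≤ (1/8)` of the symmetrised one
  have hpot8 : 8 * ∫ u, D0 u * (∑ i, a i * G i u) ^ 2 ∂configMeasure SU2 1 ≤ ∫ u, Dt u * Ψa u ^ 2 ∂configMeasure SU2 1 := by
    have h := integral_windowMoment_le_twist (L := 1) hLδ hGam hGab hGag hGas
    rw [hΨa_eq]
    exact h
  have hpot0 : 0 ≤ ∫ u, D0 u * (∑ i, a i * G i u) ^ 2 ∂configMeasure SU2 1 := integral_nonneg fun u => mul_nonneg (hD0 u) (sq_nonneg _)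
  -- the cross terms are below `λ²μ₀/28`
  have hcb : 28 * crossBound 1 B (1 / 2) ≤ lam ^ 2 * μ0 := by
    have h := (hcross B hBc).trans (mul_le_mul_of_nonneg_left (levelValue_zero_ge_uniform (L := 1) hBone) (by positivity))
    rw [e1B, one_mul] at h; exact h
  have hcb0 : 0 ≤ crossBound 1 B (1 / 2) := (crossBound_pos (L := 1) B (1 / 2)).le
  -- endgame
  set N : ℝ := l2 (fun u => ∑ i, a i * G i u) (fun u => ∑ i, a i * G i u) with hNdef
  have hN0 : 0 ≤ N := l2_self_nonneg_lat _
  set q : ℝ := qform su2Rep B (fun u => (∑ i, a i * G i u) * W' u) (fun u => (∑ i, a i * G i u) * W' u) with hqdef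
  set P : ℝ := ∫ u, D0 u * (∑ i, a i * G i u) ^ 2 ∂configMeasure SU2 1 with hPdef
  have hΛ : qform su2Rep B (fun u => W' u * Ψa u) (fun u => W' u * Ψa u) + μ * ∫ u, Dt u * Ψa u ^ 2 ∂configMeasure SU2 1 ≤
      (μk + 2 * μn * V + 2 * μ * VD + (μk - μn) * (2 * w + w ^ 2)) * (8 * N) := by
    rw [← hl2Ψ]; exact habs
  have h8q : 8 * q + 8 * (μ * P) ≤ (μk + 2 * μn * V + 2 * μ * VD + (μk - μn) * (2 * w + w ^ 2)) * (8 * N) + 56 * (crossBound 1 B (1 / 2) * (CW ^ 2 * N)) := by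
    have h1 := (abs_le.mp hq8).1
    have h2 : 56 * (crossBound 1 B (1 / 2) * l2 (fun u => (∑ i, a i * G i u) * W' u) (fun u => (∑ i, a i * G i u) * W' u)) ≤
        56 * (crossBound 1 B (1 / 2) * (CW ^ 2 * N)) := by
      have := mul_le_mul_of_nonneg_left hl2GW hcb0; linarith
    have h3 : 8 * (μ * P) ≤ μ * ∫ u, Dt u * Ψa u ^ 2 ∂configMeasure SU2 1 := by
      have := mul_le_mul_of_nonneg_left hpot8 hμ0'; linarith
    linarith [hΛ, h1, h2, h3]
  -- bound every term by a multiple of `λ² μ_k N`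
  have hterm1 : 2 * μn * V ≤ 2 * cV * lam ^ 2 * μk := by
    have h1 : μn * V ≤ μk * V := mul_le_mul_of_nonneg_right hμn_le_k hV0
    have e1 : 2 * cV * lam ^ 2 * μk = 2 * (μk * V) := by rw [hVdef]; ring
    rw [e1]; linarith
  have hterm1' : 2 * μ * VD ≤ 32 * κE * (n + 1) * S * lam ^ 2 * μk := by
    have e1 : 2 * μ * VD = 16 * κE * (n + 1) * S * lam ^ 2 * μ0 := by rw [hμdef, hVDdef]; ring
    rw [e1]
    have h0 : 0 ≤ 16 * κE * (n + 1) * S * lam ^ 2 := by positivity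
    have h1 := mul_le_mul_of_nonneg_left hμ0k h0
    have e2 : 16 * κE * (n + 1) * S * lam ^ 2 * (2 * μk) = 32 * κE * (n + 1) * S * lam ^ 2 * μk := by ring
    rw [e2] at h1; exact h1
  have hterm2 : (μk - μn) * (2 * w + w ^ 2) ≤ Cg * (2 * Real.sqrt cw2 + cw2) * lam ^ 2 * μk := by
    have hlamsq : lam ^ 2 ≤ lam := by
      calc lam ^ 2 = lam * lam := sq lam
        _ ≤ lam * 1 := mul_le_mul_of_nonneg_left hlam1 hlam0.le
        _ = lam := mul_one lam
    have hw2' : w ^ 2 = cw2 * lam ^ 2 := by rw [hwdef, mul_pow, Real.sq_sqrt hcw20]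
    have hl2 : cw2 * lam ^ 2 ≤ cw2 * lam := mul_le_mul_of_nonneg_left hlamsq hcw20
    have h2w : 2 * w + w ^ 2 ≤ (2 * Real.sqrt cw2 + cw2) * lam := by
      have e : (2 * Real.sqrt cw2 + cw2) * lam = 2 * (Real.sqrt cw2 * lam) + cw2 * lam := by ring
      have e2 : 2 * w = 2 * (Real.sqrt cw2 * lam) := by rw [hwdef]
      rw [e, hw2', e2]; linarith [hl2]
    have h0 : 0 ≤ μk - μn := by linarith
    have h2w0 : 0 ≤ 2 * w + w ^ 2 := by positivity
    calc (μk - μn) * (2 * w + w ^ 2) ≤ (Cg * lam * μk) * ((2 * Real.sqrt cw2 + cw2) * lam) :=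
          mul_le_mul hμkn h2w h2w0 (by positivity)
      _ = Cg * (2 * Real.sqrt cw2 + cw2) * lam ^ 2 * μk := by ring
  have hterm3 : 7 * (crossBound 1 B (1 / 2) * CW ^ 2) ≤ CW ^ 2 / 2 * lam ^ 2 * μk := by
    have h1 : lam ^ 2 * μ0 ≤ lam ^ 2 * (2 * μk) := mul_le_mul_of_nonneg_left (by linarith) (sq_nonneg lam)
    have h2 : 7 * crossBound 1 B (1 / 2) ≤ lam ^ 2 * μk / 2 := by linarith
    have h3 := mul_le_mul_of_nonneg_right h2 (sq_nonneg CW)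
    have e : CW ^ 2 / 2 * lam ^ 2 * μk = lam ^ 2 * μk / 2 * CW ^ 2 := by ring
    rw [e]; linarith
  have hq : q + μ * P ≤ (1 + C * lam ^ 2) * (μk * N) := by
    have h1 : q + μ * P ≤ (μk + 2 * μn * V + 2 * μ * VD + (μk - μn) * (2 * w + w ^ 2)) * N + 7 * (crossBound 1 B (1 / 2) * CW ^ 2) * N := by
      linarith [h8q]
    have h2 : (μk + 2 * μn * V + 2 * μ * VD + (μk - μn) * (2 * w + w ^ 2)) * N ≤
        (μk + 2 * cV * lam ^ 2 * μk + 32 * κE * (n + 1) * S * lam ^ 2 * μk + Cg * (2 * Real.sqrt cw2 + cw2) * lam ^ 2 * μk) * N :=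
      mul_le_mul_of_nonneg_right (by linarith [hterm1, hterm1', hterm2]) hN0
    have h3 : 7 * (crossBound 1 B (1 / 2) * CW ^ 2) * N ≤ CW ^ 2 / 2 * lam ^ 2 * μk * N := mul_le_mul_of_nonneg_right hterm3 hN0
    have h4 : (μk + 2 * cV * lam ^ 2 * μk + 32 * κE * (n + 1) * S * lam ^ 2 * μk + Cg * (2 * Real.sqrt cw2 + cw2) * lam ^ 2 * μk) * N +
        CW ^ 2 / 2 * lam ^ 2 * μk * N = (1 + C * lam ^ 2) * (μk * N) := by
      rw [hCdef]; ring
    linarith [h1, h2, h3, h4]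
  have hfin : q + μ * P ≤ Real.exp (C * lam ^ 2) * (μk * N) :=
    hq.trans (mul_le_mul_of_nonneg_right (by have := Real.add_one_le_exp (C * lam ^ 2); linarith) (mul_nonneg hμkpos.le hN0))
  have eμ : κE * levelValue su2Rep 1 B 0 * P = μ * P := by rw [hμdef]
  rw [eμ]
  calc (q + μ * P) * μ0 ≤ Real.exp (C * lam ^ 2) * (μk * N) * μ0 := mul_le_mul_of_nonneg_right hfin hμ0.le
    _ = Real.exp (C * lam ^ 2) * μk * μ0 * N := by ring

end Summit.QuantumFields.YangMills.Theorems.FemtoTransferGap.RateTube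

end
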